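import Literature.NumberTheory.DiophantineGeometry.GenEllDeFamilyGoodPrimesOrd
import Mathlib.Tactic.LinearCombination
import HarnessLib

/-!
# [GenEll] Thm. 2.1 on the `D_e` route, family `t_c`: the placewise multiplicity inequality with a
# BOUNDED DEFECT at the bad places, from a cofactor identity (no separation, no good reduction)

S. Mochizuki, *Arithmetic elliptic curves in general position*, Math. J. Okayama Univ. **52** (2010),
Prop. 1.6 p. 10 (conductor bounded by the height, reduced divisor) as used in the proof of Thm. 2.1
pp. 12–13 [cite: MochizukiGenEll2010, Prop 1.6 p.10]. Support file for the abc-iut cell's route item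
`GenEllTwo` (`stmt-ABC-19679`), work package W5 (coordinator abc-iut-w5-d045), route variant R-b
(abc-iut-w5-d241 finding F-w5d241-1: under owner RULING #6 the bad-place set of a mechanism `(c, T)`
depends on the family member `c`, so the places where SEPARATION is available must be a fixed finite set
and every other bad place needs a separation-free inequality). Classical and undisputed; nothing here
bears on [IUTchIII] Cor. 3.12.

## What is here (family `t_c = (s + c·r^{k+2})/(rs)` on `s² = 1 − 4r^{2k+1}`, `N_c = −s³ + c((k+1)r^{k+2} − 2r^{3k+3})`)

At a finite place `w` of a number field `L` with `w(2) = w(c) = 1`, for a point `(r, s, t)` of `D_e`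
with `N_c ≠ 0` and `t ∉ A` (`A` a finite set of `w`-integral values — the critical values of `t_c`):
a COFACTOR IDENTITY `D · ∏_{a ∈ A} u_a = g · N_c` with `u_a := s + c·r^{k+2} − a·(rs) = (rs)(t − a)`,
`D ≥ 1` an integer and `g` integral at `w` whenever `r` is (this is what the divisibility
`N_c ∣ D·∏_a u_a` in the coordinate ring `𝒪_K[r,s]/(s² − 1 + 4r^{2k+1})` delivers at the point —
abc-iut-w5-d054's parked instance over `HyperellipticCoordinateRingDedekind/Derivation`) gives

  `ord⁺_w N_c ≤ Σ_{a ∈ A} ord⁺_w (t − a) + ord_w D`                    (`DeC.toNat_ord_N_le_of_cofactor`)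

with NO separation hypothesis, NO good reduction of the fibre polynomials and NO converse direction
`hconv` at `w`. Cases of the proof: `w(r) > 1` ⇒ `w(N_c) > 1` (`DeC.one_lt_valuation_N_of_one_lt_valuation_r`,
the point is `w`-adically near `Q_∞`); `w(r) ≤ 1 ∧ w(t) ≤ 1` ⇒ `r, s` are units
(`DeC.valuation_r_eq_one`/`valuation_s_eq_one`, abc-iut-w5-d045) so `ord_w u_a = ord_w (t − a)`;
`w(r) ≤ 1 ∧ w(t) > 1` ⇒ every `u_a` is a `w`-UNIT (`DeC.valuation_u_eq_one_of_one_lt_valuation_t`: the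
point reduces to a special point, where `u_a` takes the unit value `±1` or `c·r^{k+2}`), so
`ord_w N_c ≤ ord_w D`. Then, for any finite `B ⊇ A`, the placewise hypotheses `hmeet`/`hoff` of
`FibreConductor.sum_logNorm_le_of_placewise` (abc-iut-w5-d009) hold at `w` with the DEFECT
`d w := ord_w D + 1` (`DeC.placewise_defect_of_cofactor`); without integrality of the values the
inequality holds with the extra pole term `Σ_{a∈A} (−ord_w a)⁺` (`DeC.toNat_ord_N_le_of_cofactor'`).
The total defect bounds (`[L:ℚ]·log D`, `Σ_a logHeight₁ a`) and the passage from the POLYNOMIAL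
cofactor identity of the coordinate ring to `(D, g)` are in the sequel `GenEllDeFamilyDefectCofactor.lean`.

No definitions (proof-only); `ord = Literature.IUT.LogVolume.ord`, `ord⁺ = Int.toNat ∘ ord`.
-/

noncomputable section

namespace Literature.NumberTheory.DiophantineGeometry.GenEll

open _root_.Polynomial NumberField IsDedekindDomain Height
open Literature.IUT.LogVolume

/-! ## Valuation lemmas for the family `t_c` (any valued field) -/

section Valued

variable {K : Type*} [Field K] {Γ₀ : Type*} [LinearOrderedCommGroupWithZero Γ₀]
  (v : Valuation K Γ₀) (k : ℕ)

/-- On `D_e` with `t·(rs) = s + c·r^{k+2}` (`c ≠ 0`): `r ≠ 0` and `s ≠ 0` (if `r = 0` then `s = 0`,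
contradicting `s² = 1`; if `s = 0` then `c·r^{k+2} = 0`); a private copy of abc-iut-w5-d054's
`DeC.r_ne_zero_and_s_ne_zero` (GenEllDeFamilyBadPrimesConverse, not imported here).
[cite: MochizukiGenEll2010, Prop 1.6 p.10] -/
private theorem DeC.rs_ne_zero_aux {c r s t : K} (hc : c ≠ 0)
    (hcurve : s ^ 2 = 1 - 4 * r ^ (2 * k + 1)) (ht : t * (r * s) = s + c * r ^ (k + 2)) :
    r ≠ 0 ∧ s ≠ 0 := by
  have hs_of_r : r = 0 → False := fun hr => by
    subst hr
    have hs : s = 0 := by simpa [zero_pow (show k + 2 ≠ 0 by omega)] using ht.symm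
    subst hs
    simp at hcurve
  refine ⟨fun hr => hs_of_r hr, fun hs => ?_⟩
  rw [hs, mul_zero, mul_zero, zero_add] at ht
  have : r ^ (k + 2) = 0 := by
    have := ht.symm
    rcases mul_eq_zero.mp this with h | h
    · exact absurd h hc
    · exact h
  exact hs_of_r (pow_eq_zero_iff (by omega) |>.mp this)

/-- `u_a := s + c·r^{k+2} − a·(rs) = (t − a)·(rs)` on `D_e`. [cite: MochizukiGenEll2010, Prop 1.6 p.10] -/
theorem DeC.u_eq_sub_mul {c r s t : K} (ht : t * (r * s) = s + c * r ^ (k + 2)) (a : K) :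
    s + c * r ^ (k + 2) - a * (r * s) = (t - a) * (r * s) := by
  linear_combination -ht

/-- **Near `Q_∞`** (`w(r) > 1`, with `w(2) = w(c) = 1`): `w(N_c) > 1`, where
`N_c = −s³ + c((k+1)r^{k+2} − 2r^{3k+3})` — the term `2c·r^{3k+3}` strictly dominates
(`w(s)² = w(r)^{2k+1}`, so `w(s³)² = w(r)^{6k+3} < w(r)^{6k+6}`). [cite: MochizukiGenEll2010, Prop 1.6 p.10] -/
theorem DeC.one_lt_valuation_N_of_one_lt_valuation_r (hv2 : v 2 = 1) {c : K} (hcv : v c = 1)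
    {r s N : K} (hcurve : s ^ 2 = 1 - 4 * r ^ (2 * k + 1))
    (hN : N = -s ^ 3 + c * ((k + 1) * r ^ (k + 2) - 2 * r ^ (3 * k + 3))) (hr : 1 < v r) :
    1 < v N := by
  have h4 : v 4 = 1 := by
    have : (4 : K) = 2 * 2 := by norm_num
    rw [this, map_mul, hv2, one_mul]
  -- `w(s²) = w(r)^{2k+1}`
  have h4r : v (4 * r ^ (2 * k + 1)) = v r ^ (2 * k + 1) := by rw [map_mul, h4, one_mul, map_pow]
  have hlt1 : v (1 : K) < v (4 * r ^ (2 * k + 1)) := by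
    rw [map_one, h4r]; exact one_lt_pow₀ hr (by omega)
  have hs2 : v s ^ 2 = v r ^ (2 * k + 1) := by
    rw [← map_pow, hcurve, Valuation.map_sub_eq_of_lt_right _ hlt1, h4r]
  -- `w(s³) < w(r)^{3k+3}`
  have hs3 : v (s ^ 3) < v r ^ (3 * k + 3) := by
    by_contra h
    push Not at h
    have h2 : (v r ^ (3 * k + 3)) ^ 2 ≤ (v (s ^ 3)) ^ 2 := pow_le_pow_left₀ zero_le h 2
    have e1 : (v (s ^ 3)) ^ 2 = v r ^ (6 * k + 3) := by
      rw [map_pow, ← pow_mul, show 3 * 2 = 2 * 3 by norm_num, pow_mul, hs2, ← pow_mul]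
      congr 1; ring
    have e2 : (v r ^ (3 * k + 3)) ^ 2 = v r ^ (6 * k + 6) := by rw [← pow_mul]; congr 1; ring
    rw [e1, e2] at h2
    exact (not_lt.mpr h2) (pow_lt_pow_right₀ hr (by omega))
  -- the `c`-term has valuation exactly `w(r)^{3k+3}`
  have hkr : v ((k + 1 : K) * r ^ (k + 2)) < v (2 * r ^ (3 * k + 3)) := by
    rw [map_mul, map_mul, hv2, one_mul, map_pow, map_pow]
    have hk1 : v (k + 1 : K) ≤ 1 := by
      have := (v.mem_integer_iff _).1 (natCast_mem v.integer (k + 1))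
      exact_mod_cast this
    calc v (k + 1 : K) * v r ^ (k + 2) ≤ 1 * v r ^ (k + 2) :=
          mul_le_mul_left hk1 _
      _ = v r ^ (k + 2) := one_mul _
      _ < v r ^ (3 * k + 3) := pow_lt_pow_right₀ hr (by omega)
  have hcterm : v (c * ((k + 1) * r ^ (k + 2) - 2 * r ^ (3 * k + 3))) = v r ^ (3 * k + 3) := by
    rw [map_mul, hcv, one_mul, Valuation.map_sub_eq_of_lt_right _ hkr, map_mul, hv2, one_mul, map_pow]
  have hneg : v (-s ^ 3) < v (c * ((k + 1) * r ^ (k + 2) - 2 * r ^ (3 * k + 3))) := by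
    rw [Valuation.map_neg, hcterm]; exact hs3
  rw [hN, Valuation.map_add_eq_of_lt_right _ hneg, hcterm]
  exact one_lt_pow₀ hr (by omega)

/-- On `D_e`, `w(r) ≤ 1 ⇒ w(s) ≤ 1` (`s² = 1 − 4r^{2k+1}` is integral). [cite: MochizukiGenEll2010, Prop 1.6 p.10] -/
theorem DeC.valuation_s_le_one_of_valuation_r_le_one {r s : K}
    (hcurve : s ^ 2 = 1 - 4 * r ^ (2 * k + 1)) (hr : v r ≤ 1) : v s ≤ 1 := by
  have h4 : v (4 : K) ≤ 1 := by
    exact_mod_cast (v.mem_integer_iff _).1 (natCast_mem v.integer 4)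
  have hs2 : v (s ^ 2) ≤ 1 := by
    rw [hcurve]
    refine v.map_sub_le (le_of_eq v.map_one) ?_
    rw [map_mul, map_pow]
    exact mul_le_one' h4 (pow_le_one' hr _)
  by_contra h
  push Not at h
  have : 1 < v (s ^ 2) := by rw [map_pow, pow_two]; exact one_lt_mul'' h h
  exact (lt_irrefl _) (this.trans_le hs2)

/-- **Near a special point at finite distance** (`w(r) ≤ 1 < w(t)`, with `w(2) = w(c) = 1`): the
numerator `u₀ := s + c·r^{k+2} = t·(rs)` is a `w`-UNIT (if `w(r) < 1` then `w(s) = 1`; if `w(r) = 1`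
then `w(s) < 1` and `w(c·r^{k+2}) = 1`) and `w(rs) < 1`. [cite: MochizukiGenEll2010, Prop 1.6 p.10] -/
theorem DeC.valuation_u0_eq_one_of_one_lt_valuation_t (hv2 : v 2 = 1) {c : K} (hcv : v c = 1)
    {r s t : K} (hcurve : s ^ 2 = 1 - 4 * r ^ (2 * k + 1)) (ht : t * (r * s) = s + c * r ^ (k + 2))
    (hr : v r ≤ 1) (htv : 1 < v t) : v (s + c * r ^ (k + 2)) = 1 ∧ v (r * s) < 1 := by
  have hc : c ≠ 0 := fun h => by rw [h, map_zero] at hcv; exact zero_ne_one hcv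
  obtain ⟨hr0, hs0⟩ := DeC.rs_ne_zero_aux k hc hcurve ht
  have hs := DeC.valuation_s_le_one_of_valuation_r_le_one v k hcurve hr
  have hrs0 : v (r * s) ≠ 0 := (v.ne_zero_iff).mpr (mul_ne_zero hr0 hs0)
  -- `w(u₀) = w(t)·w(rs) > w(rs)`
  have hu0 : v (s + c * r ^ (k + 2)) = v t * v (r * s) := by rw [← ht, map_mul]
  have hgt : v (r * s) < v (s + c * r ^ (k + 2)) := by
    rw [hu0]
    calc v (r * s) = 1 * v (r * s) := (one_mul _).symm
      _ < v t * v (r * s) := mul_lt_mul_of_pos_right htv (zero_lt_iff.mpr hrs0)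
  have hu0le : v (s + c * r ^ (k + 2)) ≤ 1 := by
    refine v.map_add_le hs ?_
    rw [map_mul, hcv, one_mul, map_pow]; exact pow_le_one' hr _
  have h4 : v (4 : K) = 1 := by
    have : (4 : K) = 2 * 2 := by norm_num
    rw [this, map_mul, hv2, one_mul]
  rcases hr.lt_or_eq with hrlt | hreq
  · -- `w(r) < 1`: `w(s) = 1`
    have h4r : v (4 * r ^ (2 * k + 1)) < v (1 : K) := by
      rw [map_mul, h4, one_mul, map_pow, map_one]; exact pow_lt_one₀ zero_le hrlt (by omega)
    have hs1 : v s = 1 := by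
      have hs2 : v (s ^ 2) = 1 := by rw [hcurve, Valuation.map_sub_eq_of_lt_left _ h4r, map_one]
      rw [map_pow] at hs2
      rcases hs.lt_or_eq with h | h
      · exact absurd hs2 (ne_of_lt (pow_lt_one₀ zero_le h two_ne_zero))
      · exact h
    have hcr : v (c * r ^ (k + 2)) < v s := by
      rw [map_mul, hcv, one_mul, map_pow, hs1]; exact pow_lt_one₀ zero_le hrlt (by omega)
    refine ⟨by rw [Valuation.map_add_eq_of_lt_left _ hcr, hs1], ?_⟩
    rw [map_mul, hs1, mul_one]; exact hrlt
  · -- `w(r) = 1`: `w(s) < 1`, `w(c·r^{k+2}) = 1`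
    have hrs : v (r * s) = v s := by rw [map_mul, hreq, one_mul]
    have hslt : v s < 1 := by
      rw [hrs] at hgt
      exact lt_of_lt_of_le hgt hu0le
    have hcr : v s < v (c * r ^ (k + 2)) := by
      rw [map_mul, hcv, one_mul, map_pow, hreq, one_pow]; exact hslt
    refine ⟨?_, by rw [hrs]; exact hslt⟩
    rw [Valuation.map_add_eq_of_lt_right _ hcr, map_mul, hcv, one_mul, map_pow, hreq, one_pow]

/-- Under `w(r) ≤ 1 < w(t)` (`w(2) = w(c) = 1`), every `u_a = s + c·r^{k+2} − a·(rs)` with `a`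
integral is a `w`-UNIT. [cite: MochizukiGenEll2010, Prop 1.6 p.10] -/
theorem DeC.valuation_u_eq_one_of_one_lt_valuation_t (hv2 : v 2 = 1) {c : K} (hcv : v c = 1)
    {r s t : K} (hcurve : s ^ 2 = 1 - 4 * r ^ (2 * k + 1)) (ht : t * (r * s) = s + c * r ^ (k + 2))
    (hr : v r ≤ 1) (htv : 1 < v t) {a : K} (ha : v a ≤ 1) :
    v (s + c * r ^ (k + 2) - a * (r * s)) = 1 := by
  obtain ⟨hu0, hrs⟩ := DeC.valuation_u0_eq_one_of_one_lt_valuation_t v k hv2 hcv hcurve ht hr htv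
  have hars : v (a * (r * s)) < v (s + c * r ^ (k + 2)) := by
    rw [hu0, map_mul]
    calc v a * v (r * s) ≤ 1 * v (r * s) := mul_le_mul_left ha _
      _ = v (r * s) := one_mul _
      _ < 1 := hrs
  rw [Valuation.map_sub_eq_of_lt_left _ hars, hu0]

end Valued

/-! ## The placewise inequality with bounded defect at a finite place of a number field -/

section NumberFieldPlace

variable {L : Type*} [Field L] [NumberField L]

/-- `ord_w` of a finite product of nonzero elements is the sum of the `ord_w` (file plumbing).
[cite: MochizukiGenEll2010, Thm 2.1 proof pp.12-13] -/
theorem ord_finset_prod {ι : Type*} (w : HeightOneSpectrum (𝓞 L)) (s : Finset ι) (f : ι → L)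
    (hf : ∀ i ∈ s, f i ≠ 0) : ord L w (∏ i ∈ s, f i) = ∑ i ∈ s, ord L w (f i) := by
  classical
  induction s using Finset.induction_on with
  | empty => simp [ord_one]
  | insert a s ha ih =>
    rw [Finset.prod_insert ha, Finset.sum_insert ha,
      ord_mul L w (hf a (Finset.mem_insert_self a s))
        (Finset.prod_ne_zero_iff.mpr fun i hi => hf i (Finset.mem_insert_of_mem hi)),
      ih fun i hi => hf i (Finset.mem_insert_of_mem hi)]

/-- `0 ≤ ord_w x` when `w(x) ≤ 1` (file plumbing). [cite: MochizukiGenEll2010, Thm 2.1 proof pp.12-13] -/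
theorem ord_nonneg_of_valuation_le_one (w : HeightOneSpectrum (𝓞 L)) {x : L}
    (hx : w.valuation L x ≤ 1) : 0 ≤ ord L w x := by
  by_cases hx0 : x = 0
  · rw [hx0, ord_zero]
  · by_contra h
    push Not at h
    exact (not_lt.mpr hx) ((ord_neg_iff_one_lt_valuation L w hx0).mp h)

/-- **The multiplicity inequality with bounded defect, from a cofactor identity** ([GenEll] Prop. 1.6
for the reduced divisor `t_c⁻¹(A)` on `D_e`, at an ARBITRARY finite place — no separation, no good
reduction, no integrality of the values). At a finite place `w` of a number field `L` with
`w(2) = w(c) = 1`, let `(r, s, t)` be a point of `D_e` (`s² = 1 − 4r^{2k+1}`, `t·(rs) = s + c·r^{k+2}`) with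
`N_c ≠ 0` and `t ∉ A` (`A` finite), and suppose the COFACTOR IDENTITY `D · ∏_{a∈A} u_a = g · N_c`
(`u_a = s + c·r^{k+2} − a·(rs)`, `D ≥ 1` an integer, `g` integral at `w` as soon as `r` is). Then
`ord⁺_w N_c ≤ Σ_{a∈A} ord⁺_w (t − a) + ord_w D + Σ_{a∈A} (−ord_w a)⁺` — the last sum (the pole orders of
the values `a` at `w`) vanishes at every place where `A` is integral, i.e. off a finite set depending only
on `A`. [cite: MochizukiGenEll2010, Prop 1.6 p.10] -/
theorem DeC.toNat_ord_N_le_of_cofactor' (w : HeightOneSpectrum (𝓞 L)) (k : ℕ) {c : L}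
    (hv2 : w.valuation L 2 = 1) (hcv : w.valuation L c = 1)
    {r s t N : L} (hcurve : s ^ 2 = 1 - 4 * r ^ (2 * k + 1)) (ht : t * (r * s) = s + c * r ^ (k + 2))
    (hN : N = -s ^ 3 + c * ((k + 1) * r ^ (k + 2) - 2 * r ^ (3 * k + 3))) (hN0 : N ≠ 0)
    (A : Finset L) (htA : ∀ a ∈ A, t ≠ a)
    (D : ℕ) (hD : D ≠ 0) (g : L)
    (hid : (D : L) * ∏ a ∈ A, (s + c * r ^ (k + 2) - a * (r * s)) = g * N)
    (hg : w.valuation L r ≤ 1 → w.valuation L g ≤ 1) :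
    (ord L w N).toNat ≤ (∑ a ∈ A, (ord L w (t - a)).toNat) + (ord L w (D : L)).toNat +
      ∑ a ∈ A, (-ord L w a).toNat := by
  classical
  set v := w.valuation L with hv
  have hc : c ≠ 0 := fun h => by rw [h, map_zero] at hcv; exact zero_ne_one hcv
  obtain ⟨hr0, hs0⟩ := DeC.rs_ne_zero_aux k hc hcurve ht
  have hD0 : (D : L) ≠ 0 := Nat.cast_ne_zero.mpr hD
  -- the integer `D` is integral: `0 ≤ ord_w D`
  have hDint : 0 ≤ ord L w (D : L) :=
    ord_nonneg_of_valuation_le_one w ((v.mem_integer_iff _).1 (natCast_mem v.integer D))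
  by_cases hr : 1 < v r
  · -- near `Q_∞`: `N_c` is large, `ord⁺ N_c = 0`
    have hN1 := DeC.one_lt_valuation_N_of_one_lt_valuation_r v k hv2 hcv hcurve hN hr
    have : ord L w N < 0 := (ord_neg_iff_one_lt_valuation L w hN0).mpr hN1
    rw [Int.toNat_eq_zero.mpr this.le]
    exact Nat.zero_le _
  · push Not at hr
    -- every `u_a` is nonzero
    have hu0 : ∀ a ∈ A, s + c * r ^ (k + 2) - a * (r * s) ≠ 0 := fun a ha => by
      rw [DeC.u_eq_sub_mul k ht a]
      exact mul_ne_zero (sub_ne_zero.mpr (htA a ha)) (mul_ne_zero hr0 hs0)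
    have hprod0 : ∏ a ∈ A, (s + c * r ^ (k + 2) - a * (r * s)) ≠ 0 :=
      Finset.prod_ne_zero_iff.mpr hu0
    have hg0 : g ≠ 0 := by
      intro h0
      rw [h0, zero_mul] at hid
      exact (mul_ne_zero hD0 hprod0) hid
    -- `ord` of the identity: `ord D + Σ ord u_a = ord g + ord N`, with `ord g ≥ 0`
    have hordid : ord L w (D : L) + ∑ a ∈ A, ord L w (s + c * r ^ (k + 2) - a * (r * s)) =
        ord L w g + ord L w N := by
      rw [← ord_finset_prod w A _ hu0, ← ord_mul L w hD0 hprod0, hid, ord_mul L w hg0 hN0]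
    have hgint : 0 ≤ ord L w g := ord_nonneg_of_valuation_le_one w (hg hr)
    have hNle : ord L w N ≤ ord L w (D : L) + ∑ a ∈ A, ord L w (s + c * r ^ (k + 2) - a * (r * s)) := by
      rw [hordid]; linarith
    -- compare `ord u_a` with `ord⁺ (t − a) + (−ord a)⁺`, value by value
    have hsum : ∑ a ∈ A, ord L w (s + c * r ^ (k + 2) - a * (r * s)) ≤
        ∑ a ∈ A, (((ord L w (t - a)).toNat : ℤ) + ((-ord L w a).toNat : ℤ)) := by
      refine Finset.sum_le_sum fun a ha => ?_
      have hta0 : t - a ≠ 0 := sub_ne_zero.mpr (htA a ha)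
      have hpole : (0 : ℤ) ≤ ((-ord L w a).toNat : ℤ) := Int.natCast_nonneg _
      by_cases htv : v t ≤ 1
      · -- `r, s` units: `ord u_a = ord (t − a)`
        have hr1 := DeC.valuation_r_eq_one v k hcv hcurve ht htv
        have hs1 := (DeC.valuation_s_eq_one v k hcv hcurve ht htv).1
        rw [DeC.u_eq_sub_mul k ht a, ord_mul L w hta0 (mul_ne_zero hr0 hs0),
          ord_mul L w hr0 hs0, ord_eq_zero_of_valuation_eq_one w hr1,
          ord_eq_zero_of_valuation_eq_one w hs1, add_zero, add_zero]
        exact (Int.self_le_toNat _).trans (le_add_of_nonneg_right hpole)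
      · -- `w(t) > 1`: `u₀ = s + c r^{k+2}` is a unit and `w(rs) < 1`
        push Not at htv
        obtain ⟨hu1, hrs⟩ :=
          DeC.valuation_u0_eq_one_of_one_lt_valuation_t v k hv2 hcv hcurve ht hr htv
        by_cases hars : v (a * (r * s)) < 1
        · -- `u_a` is a unit
          have : v (s + c * r ^ (k + 2) - a * (r * s)) = 1 := by
            rw [Valuation.map_sub_eq_of_lt_left _ (by rw [hu1]; exact hars), hu1]
          rw [ord_eq_zero_of_valuation_eq_one w this]
          exact add_nonneg (Int.natCast_nonneg _) hpole
        · -- `w(a·rs) ≥ 1`: then `ord a + ord (rs) ≤ 0`, and `ord u_a = ord (t − a) + ord (rs)`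
          push Not at hars
          have ha0 : a ≠ 0 := by
            rintro rfl
            rw [zero_mul, map_zero] at hars
            exact not_lt.mpr hars zero_lt_one
          have hars0 : a * (r * s) ≠ 0 := mul_ne_zero ha0 (mul_ne_zero hr0 hs0)
          have hordars : ord L w (a * (r * s)) ≤ 0 := ord_nonpos_of_one_le_valuation w hars
          rw [ord_mul L w ha0 (mul_ne_zero hr0 hs0)] at hordars
          rw [DeC.u_eq_sub_mul k ht a, ord_mul L w hta0 (mul_ne_zero hr0 hs0)]
          have h1 : ord L w (t - a) ≤ ((ord L w (t - a)).toNat : ℤ) := Int.self_le_toNat _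
          have h2 : -ord L w a ≤ ((-ord L w a).toNat : ℤ) := Int.self_le_toNat _
          linarith
    -- conclude
    have hfin : ord L w N ≤ (∑ a ∈ A, (((ord L w (t - a)).toNat : ℤ) + ((-ord L w a).toNat : ℤ))) +
        ord L w (D : L) := by
      linarith
    rw [Finset.sum_add_distrib] at hfin
    have hDnat : ((ord L w (D : L)).toNat : ℤ) = ord L w (D : L) := Int.toNat_of_nonneg hDint
    zify
    rw [hDnat]
    rcases le_or_gt 0 (ord L w N) with h | h
    · rw [Int.toNat_of_nonneg h]; linarith
    · rw [Int.toNat_eq_zero.mpr h.le]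
      push_cast
      have h1 : (0 : ℤ) ≤ ∑ a ∈ A, ((ord L w (t - a)).toNat : ℤ) :=
        Finset.sum_nonneg fun a _ => Int.natCast_nonneg _
      have h2 : (0 : ℤ) ≤ ∑ a ∈ A, ((-ord L w a).toNat : ℤ) :=
        Finset.sum_nonneg fun a _ => Int.natCast_nonneg _
      linarith

/-- **The multiplicity inequality with bounded defect, integral values.** As
`DeC.toNat_ord_N_le_of_cofactor'` at a place where the values `a ∈ A` are `w`-integral (all places of
`L` outside a finite set depending only on `A`): `ord⁺_w N_c ≤ Σ_{a∈A} ord⁺_w (t − a) + ord_w D`.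
[cite: MochizukiGenEll2010, Prop 1.6 p.10] -/
theorem DeC.toNat_ord_N_le_of_cofactor (w : HeightOneSpectrum (𝓞 L)) (k : ℕ) {c : L}
    (hv2 : w.valuation L 2 = 1) (hcv : w.valuation L c = 1)
    {r s t N : L} (hcurve : s ^ 2 = 1 - 4 * r ^ (2 * k + 1)) (ht : t * (r * s) = s + c * r ^ (k + 2))
    (hN : N = -s ^ 3 + c * ((k + 1) * r ^ (k + 2) - 2 * r ^ (3 * k + 3))) (hN0 : N ≠ 0)
    (A : Finset L) (htA : ∀ a ∈ A, t ≠ a) (hA : ∀ a ∈ A, w.valuation L a ≤ 1)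
    (D : ℕ) (hD : D ≠ 0) (g : L)
    (hid : (D : L) * ∏ a ∈ A, (s + c * r ^ (k + 2) - a * (r * s)) = g * N)
    (hg : w.valuation L r ≤ 1 → w.valuation L g ≤ 1) :
    (ord L w N).toNat ≤ (∑ a ∈ A, (ord L w (t - a)).toNat) + (ord L w (D : L)).toNat := by
  have h := DeC.toNat_ord_N_le_of_cofactor' w k hv2 hcv hcurve ht hN hN0 A htA D hD g hid hg
  have hzero : ∑ a ∈ A, (-ord L w a).toNat = 0 :=
    Finset.sum_eq_zero fun a ha =>
      Int.toNat_eq_zero.mpr (by have := ord_nonneg_of_valuation_le_one w (hA a ha); omega)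
  omega

/-- **Placewise hypotheses with defect** (the shape of `FibreConductor.sum_logNorm_le_of_placewise`,
abc-iut-w5-d009): under the hypotheses of `DeC.toNat_ord_N_le_of_cofactor`, for every finite `B ⊇ A`
both `1 + ord⁺_w N_c ≤ Σ_{b∈B} ord⁺_w (t − b) + (ord_w D + 1)` and
`ord⁺_w N_c ≤ Σ_{b∈B} ord⁺_w (t − b) + (ord_w D + 1)` hold at `w` — `hmeet`/`hoff` at a BAD place with the
defect `d w := ord_w D + 1`, whatever the meeting set. [cite: MochizukiGenEll2010, Prop 1.6 p.10] -/
theorem DeC.placewise_defect_of_cofactor (w : HeightOneSpectrum (𝓞 L)) (k : ℕ) {c : L}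
    (hv2 : w.valuation L 2 = 1) (hcv : w.valuation L c = 1)
    {r s t N : L} (hcurve : s ^ 2 = 1 - 4 * r ^ (2 * k + 1)) (ht : t * (r * s) = s + c * r ^ (k + 2))
    (hN : N = -s ^ 3 + c * ((k + 1) * r ^ (k + 2) - 2 * r ^ (3 * k + 3))) (hN0 : N ≠ 0)
    (A B : Finset L) (hAB : A ⊆ B) (htA : ∀ a ∈ A, t ≠ a) (hA : ∀ a ∈ A, w.valuation L a ≤ 1)
    (D : ℕ) (hD : D ≠ 0) (g : L)
    (hid : (D : L) * ∏ a ∈ A, (s + c * r ^ (k + 2) - a * (r * s)) = g * N)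
    (hg : w.valuation L r ≤ 1 → w.valuation L g ≤ 1) :
    1 + (ord L w N).toNat ≤ (∑ b ∈ B, (ord L w (t - b)).toNat) + ((ord L w (D : L)).toNat + 1) ∧
      (ord L w N).toNat ≤ (∑ b ∈ B, (ord L w (t - b)).toNat) + ((ord L w (D : L)).toNat + 1) := by
  have h := DeC.toNat_ord_N_le_of_cofactor w k hv2 hcv hcurve ht hN hN0 A htA hA D hD g hid hg
  have hmono : (∑ a ∈ A, (ord L w (t - a)).toNat) ≤ ∑ b ∈ B, (ord L w (t - b)).toNat :=
    Finset.sum_le_sum_of_subset_of_nonneg hAB fun _ _ _ => Nat.zero_le _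
  constructor <;> omega

end NumberFieldPlace

end Literature.NumberTheory.DiophantineGeometry.GenEll

end
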